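import Literature.Analysis.OperatorTheory.YangMillsMatrixModelDiscreteSpectrum
import Mathlib.Analysis.SpecialFunctions.SmoothTransition
import Mathlib.Analysis.InnerProductSpace.Calculus
import Mathlib.MeasureTheory.Integral.Bochner.Set
import HarnessLib

/-!
# The min–max levels of Lüscher's `SU(2)` matrix-model Hamiltonian are genuine infima — PROVED

Topic `Literature/Analysis/OperatorTheory`, a proofs sibling of `YangMillsMatrixModelDiscreteSpectrum.lean`,
whose module docstring ASSERTS (section "Lean conventions (well-posedness of the concrete min–max)") but
does not prove: *"`minmaxLevel adm k` is an `sInf` over `ℝ`: for `k ≥ 1` and `adm ⊆ IsTestFn` the set is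
bounded below by `0` … and non-empty (there are `k` linearly independent colour-rotation-invariant `C²_c`
functions, e.g. radial bumps with disjoint supports), so it is the genuine infimum = the `k`-th min–max
level"*.  Since `Real.sInf ∅ = 0` and `Real.sInf` of a set unbounded below is meaningless, every use of
`physLevel k` and of Lüscher's `ε₁ = luscherEps1 = physLevel 2 − physLevel 1` BY NAME (tree:
`Balaban1983to89/FemtoUniverseGap.lean` §3, `Summits/…/Theorems/FemtoTransferGap.lean`) silently relies on
these two facts.  This file proves them, and the first consequences of the min–max principle
([ReedSimonIV1978] Thm. XIII.1, the subspace form (2a)/(2b) used in the tree's `minmaxLevel`):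

* `shellFn m` — the radial shells `ψ_m(x) = h(‖x‖² − (2m+1))·h((2m+2) − ‖x‖²)` (`h` = Mathlib's
  `Real.smoothTransition`): smooth, compactly supported (`isTestFn_shellFn`), COLOUR-ROTATION INVARIANT
  (`isGaugeInv_shellFn`, via `norm_colourRotate`: `SO(3)` acting diagonally on the three colour vectors is
  an isometry of `ℝ⁹`), pairwise disjointly supported, linearly independent (`linearIndependent_shellFn`,
  private points `shellPoint m`), spanning the `k`-dimensional admissible space `shellSpace k`
  (`finrank_shellSpace`, `adm_of_mem_shellSpace`);
* `energyForm_sum_smul_shellFn`, `l2sq_sum_smul_shellFn` — on `shellSpace k` the energy form and the `L²`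
  norm are DIAGONAL, `𝔮(Σ c_m ψ_m) = Σ c_m² 𝔮(ψ_m)` (at each point at most one shell is active, for values
  and gradients: `energyIntegrand_sum_smul_shellFn`), whence the explicit Rayleigh bound
  `energyForm_le_shellBound_mul`: `𝔮(ψ) ≤ s_k ‖ψ‖²` on `shellSpace k`, `s_k = shellBound k = Σ_{m<k} 𝔮(ψ_m)/‖ψ_m‖²`;
* ★ `levelSet_nonempty` — the Rayleigh set of every order `k` is NON-EMPTY (`shellBound_mem_levelSet`);
* ★ `levelSet_bddBelow` / `nonneg_of_mem_levelSet` — for `k ≥ 1` every element of the Rayleigh set is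
  `≥ 0` (a `k`-dimensional space contains a non-zero continuous compactly supported `ψ`, whose
  `‖ψ‖²_{L²} > 0`: `l2sq_pos_of_ne_zero`, and `𝔮 ≥ 0`);
* `levelSet_succ_subset` — the Rayleigh sets decrease with the order (restriction to a `k`-dimensional
  subspace of a `(k+1)`-dimensional one);
* consequences: `physLevel_nonneg` (`μ_k ≥ 0`), `physLevel_le_of_mem`, `physLevel_le_shellBound`
  (`μ_k ≤ s_k < ∞`), `physLevel_le_succ` / `physLevel_mono` (**`μ_1 ≤ μ_2 ≤ ⋯`**), ★ `luscherEps1_nonneg`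
  (**`0 ≤ ε₁`**), `physLevel_one_le_rayleigh` (`μ_1 ≤ 𝔮(ψ)/‖ψ‖²` for every non-zero admissible `ψ`),
  `energyForm_smul`, `l2sq_smul` (quadratic scaling).

Everything is proved (`propext`, `Classical.choice`, `Quot.sound`); no named fact.  NOT here (the content of
the named fact `LuscherSimonGap`, still a hypothesis where used): `μ_k → ∞` (discrete spectrum, B. Simon 1983
Cor. 4 / Reed–Simon XIII.64) and the STRICT inequality `0 < ε₁` (simplicity of the ground state, Reed–Simon
XIII.48); the zero-point form bound `𝔮(ψ) ≥ ⅔∫‖x‖ψ²` is the sibling `YangMillsMatrixModelValleyBound.lean`.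

## References

* [ReedSimonIV1978] M. Reed, B. Simon, *Methods of Modern Mathematical Physics IV: Analysis of Operators*,
  Academic Press (1978), §XIII.1: Thm. XIII.1 (min–max principle; subspace form (2a)/(2b) in its proof),
  Thm. XIII.2 (the same over a form core, here `C²_c`).
* [Luscher1983] M. Lüscher, Nucl. Phys. B 219 (1983) 233–261, §1 (`ε₁`: `E = ε₁ g^{2/3}/L + …`).
* [Vanbaal2001] P. van Baal, *QCD in a finite volume*, hep-ph/0008206, §4 (the zero-momentum effective
  Hamiltonian and its residual gauge group `SO(3)`).
* [SimonB1983DiscreteSpectrum] B. Simon, Ann. Phys. 146 (1983) 209–220, eq. (3) p. 211 (the operator).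
-/

noncomputable section

open Matrix MeasureTheory Filter Topology
open scoped BigOperators

namespace Literature.Analysis.OperatorTheory.YMMatrixModel

/-! ### 1. Radial shell test functions -/

/-- The shell profile `g_m(t) = h(t − (2m+1))·h((2m+2) − t)`, `h` = Mathlib's `Real.smoothTransition`:
smooth, `≥ 0`, positive exactly on `(2m+1, 2m+2)`. [folklore] -/
def shellProfile (m : ℕ) (t : ℝ) : ℝ :=
  Real.smoothTransition (t - (2 * m + 1)) * Real.smoothTransition (2 * m + 2 - t)

/-- Smoothness of the profile. [cite: ReedSimonIV1978, Thm. XIII.2] -/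
theorem shellProfile_contDiff (m : ℕ) {n : ℕ∞} : ContDiff ℝ n (shellProfile m) :=
  (Real.smoothTransition.contDiff.comp (contDiff_id.sub contDiff_const)).mul
    (Real.smoothTransition.contDiff.comp (contDiff_const.sub contDiff_id))

/-- `g_m ≥ 0`. [cite: ReedSimonIV1978, Thm. XIII.2] -/
theorem shellProfile_nonneg (m : ℕ) (t : ℝ) : 0 ≤ shellProfile m t :=
  mul_nonneg (Real.smoothTransition.nonneg _) (Real.smoothTransition.nonneg _)

/-- `g_m(t) = 0` for `t ≤ 2m+1`. [cite: ReedSimonIV1978, Thm. XIII.2] -/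
theorem shellProfile_eq_zero_of_le {m : ℕ} {t : ℝ} (ht : t ≤ 2 * m + 1) : shellProfile m t = 0 := by
  rw [shellProfile, Real.smoothTransition.zero_of_nonpos (by linarith), zero_mul]

/-- `g_m(t) = 0` for `t ≥ 2m+2`. [cite: ReedSimonIV1978, Thm. XIII.2] -/
theorem shellProfile_eq_zero_of_ge {m : ℕ} {t : ℝ} (ht : 2 * m + 2 ≤ t) : shellProfile m t = 0 := by
  rw [shellProfile, Real.smoothTransition.zero_of_nonpos (x := 2 * m + 2 - t) (by linarith), mul_zero]

/-- `g_m(t) > 0` for `2m+1 < t < 2m+2`. [cite: ReedSimonIV1978, Thm. XIII.2] -/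
theorem shellProfile_pos {m : ℕ} {t : ℝ} (h1 : 2 * m + 1 < t) (h2 : t < 2 * m + 2) :
    0 < shellProfile m t :=
  mul_pos (Real.smoothTransition.pos_of_pos (by linarith)) (Real.smoothTransition.pos_of_pos (by linarith))

/-- Off the closed shell `[2m+1, 2m+2]` the profile vanishes. [cite: ReedSimonIV1978, Thm. XIII.2] -/
theorem shellProfile_eq_zero_of_not_mem {m : ℕ} {t : ℝ} (ht : ¬ (2 * m + 1 ≤ t ∧ t ≤ 2 * m + 2)) :
    shellProfile m t = 0 := by
  rcases not_and_or.1 ht with h | h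
  · exact shellProfile_eq_zero_of_le (le_of_lt (not_le.1 h))
  · exact shellProfile_eq_zero_of_ge (le_of_lt (not_le.1 h))

/-- The radial shell test function `ψ_m(x) = g_m(‖x‖²)` on `ℝ⁹`. [folklore] -/
def shellFn (m : ℕ) (x : ZM) : ℝ := shellProfile m (‖x‖ ^ 2)

/-- `ψ_m` is smooth. [cite: ReedSimonIV1978, Thm. XIII.2] -/
theorem shellFn_contDiff (m : ℕ) {n : ℕ∞} : ContDiff ℝ n (shellFn m) :=
  (shellProfile_contDiff m).comp (contDiff_norm_sq ℝ)

/-- `ψ_m ≥ 0`. [cite: ReedSimonIV1978, Thm. XIII.2] -/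
theorem shellFn_nonneg (m : ℕ) (x : ZM) : 0 ≤ shellFn m x := shellProfile_nonneg m _

/-- `ψ_m` is supported in the ball of radius `√(2m+2)`. [cite: ReedSimonIV1978, Thm. XIII.2] -/
theorem shellFn_eq_zero_of_norm_sq_ge {m : ℕ} {x : ZM} (hx : 2 * m + 2 ≤ ‖x‖ ^ 2) : shellFn m x = 0 :=
  shellProfile_eq_zero_of_ge hx

/-- `ψ_m` has compact support. [cite: ReedSimonIV1978, Thm. XIII.2] -/
theorem shellFn_hasCompactSupport (m : ℕ) : HasCompactSupport (shellFn m) := by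
  refine HasCompactSupport.intro (isCompact_closedBall (0 : ZM) (Real.sqrt (2 * m + 2))) fun x hx => ?_
  rw [Metric.mem_closedBall, dist_zero_right, not_le] at hx
  apply shellFn_eq_zero_of_norm_sq_ge
  have h0 : (0 : ℝ) ≤ 2 * m + 2 := by positivity
  have h1 : Real.sqrt (2 * m + 2) ^ 2 = 2 * m + 2 := Real.sq_sqrt h0
  nlinarith [Real.sqrt_nonneg (2 * (m : ℝ) + 2), norm_nonneg x]

/-- `ψ_m` is a trial function (`C²_c`). [cite: ReedSimonIV1978, Thm. XIII.2] -/
theorem isTestFn_shellFn (m : ℕ) : IsTestFn (shellFn m) :=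
  ⟨by
    have h := shellFn_contDiff m (n := 2)
    exact_mod_cast h, shellFn_hasCompactSupport m⟩

/-! ### 2. Colour rotations are isometries of `ℝ⁹`; the shells are gauge invariant -/

/-- For `R ∈ SO(3)`: `Σ_a R_{ab} R_{ac} = δ_{bc}`. [cite: Vanbaal2001, §4] -/
theorem sum_mul_eq_of_mem_SO {R : Matrix (Fin 3) (Fin 3) ℝ}
    (hR : R ∈ Matrix.specialOrthogonalGroup (Fin 3) ℝ) (b c : Fin 3) :
    ∑ a, R a b * R a c = if b = c then 1 else 0 := by
  have h1 : star R * R = 1 := Matrix.mem_unitaryGroup_iff'.1 hR.1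
  have h2 := congrFun (congrFun h1 b) c
  rw [Matrix.mul_apply, Matrix.one_apply] at h2
  simpa [Matrix.star_apply] using h2

/-- Colour rotations preserve the Euclidean norm of `ℝ⁹ = (ℝ³)³`. [cite: Vanbaal2001, §4] -/
theorem norm_colourRotate {R : Matrix (Fin 3) (Fin 3) ℝ}
    (hR : R ∈ Matrix.specialOrthogonalGroup (Fin 3) ℝ) (x : ZM) : ‖colourRotate R x‖ = ‖x‖ := by
  have key : ∀ i : Fin 3,
      ∑ a, (∑ b, R a b * x (i, b)) * (∑ c, R a c * x (i, c)) = ∑ b, x (i, b) * x (i, b) := by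
    intro i
    calc ∑ a, (∑ b, R a b * x (i, b)) * (∑ c, R a c * x (i, c))
        = ∑ a, ∑ b, ∑ c, R a b * x (i, b) * (R a c * x (i, c)) := by
          refine Finset.sum_congr rfl fun a _ => ?_
          rw [Finset.sum_mul_sum]
      _ = ∑ b, ∑ c, ∑ a, R a b * x (i, b) * (R a c * x (i, c)) := by
          rw [Finset.sum_comm]
          refine Finset.sum_congr rfl fun b _ => ?_
          rw [Finset.sum_comm]
      _ = ∑ b, ∑ c, (if b = c then 1 else 0) * (x (i, b) * x (i, c)) := by
          refine Finset.sum_congr rfl fun b _ => Finset.sum_congr rfl fun c _ => ?_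
          rw [← sum_mul_eq_of_mem_SO hR b c, Finset.sum_mul]
          exact Finset.sum_congr rfl fun a _ => by ring
      _ = ∑ b, x (i, b) * x (i, b) := by
          refine Finset.sum_congr rfl fun b _ => ?_
          simp [ite_mul, Finset.sum_ite_eq]
  have hsq : ‖colourRotate R x‖ ^ 2 = ‖x‖ ^ 2 := by
    rw [EuclideanSpace.real_norm_sq_eq, EuclideanSpace.real_norm_sq_eq, Fintype.sum_prod_type,
      Fintype.sum_prod_type]
    refine Finset.sum_congr rfl fun i _ => ?_
    have hc : ∀ a, (colourRotate R x) (i, a) = ∑ b, R a b * x (i, b) := fun a => rfl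
    simp_rw [hc, sq]
    exact key i
  have h1 : 0 ≤ ‖colourRotate R x‖ := norm_nonneg _
  have h2 : 0 ≤ ‖x‖ := norm_nonneg _
  nlinarith [hsq]

/-- The shell functions are colour-rotation (gauge) invariant. [cite: Vanbaal2001, §4] -/
theorem isGaugeInv_shellFn (m : ℕ) : IsGaugeInv (shellFn m) := fun R hR x => by
  simp only [shellFn, norm_colourRotate hR]


/-! ### 3. `k` linearly independent gauge-invariant trial functions -/

/-- The private point `x_m = √(2m + 3/2) · e_{(0,0)}` of the `m`-th shell. [folklore] -/
def shellPoint (m : ℕ) : ZM := Real.sqrt (2 * m + 3 / 2) • EuclideanSpace.single ((0 : Fin 3), (0 : Fin 3)) (1 : ℝ)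

/-- `‖x_m‖² = 2m + 3/2`. [cite: ReedSimonIV1978, Thm. XIII.2] -/
theorem norm_sq_shellPoint (m : ℕ) : ‖shellPoint m‖ ^ 2 = 2 * m + 3 / 2 := by
  have h0 : (0 : ℝ) ≤ 2 * m + 3 / 2 := by positivity
  rw [shellPoint, norm_smul, Real.norm_of_nonneg (Real.sqrt_nonneg _)]
  simp [Real.sq_sqrt h0]

/-- `ψ_m(x_m) > 0`. [cite: ReedSimonIV1978, Thm. XIII.2] -/
theorem shellFn_shellPoint_pos (m : ℕ) : 0 < shellFn m (shellPoint m) := by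
  rw [shellFn, norm_sq_shellPoint]
  exact shellProfile_pos (by linarith) (by linarith)

/-- `ψ_{m'}(x_m) = 0` for `m' ≠ m` (the shells are disjoint). [cite: ReedSimonIV1978, Thm. XIII.2] -/
theorem shellFn_shellPoint_of_ne {m m' : ℕ} (h : m' ≠ m) : shellFn m' (shellPoint m) = 0 := by
  rw [shellFn, norm_sq_shellPoint]
  rcases lt_or_gt_of_ne h with hlt | hgt
  · apply shellProfile_eq_zero_of_ge
    have : (m' : ℝ) + 1 ≤ m := by exact_mod_cast hlt
    linarith
  · apply shellProfile_eq_zero_of_le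
    have : (m : ℝ) + 1 ≤ m' := by exact_mod_cast hgt
    linarith

/-- The first `k` shell functions are linearly independent. [cite: ReedSimonIV1978, Thm. XIII.1] -/
theorem linearIndependent_shellFn (k : ℕ) :
    LinearIndependent ℝ (fun m : Fin k => shellFn (m : ℕ)) := by
  rw [linearIndependent_iff']
  intro s g hg i hi
  have h := congrFun hg (shellPoint (i : ℕ))
  simp only [Finset.sum_apply, Pi.smul_apply, smul_eq_mul, Pi.zero_apply] at h
  rw [Finset.sum_eq_single i] at h
  · exact (mul_eq_zero.1 h).resolve_right (shellFn_shellPoint_pos (i : ℕ)).ne'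
  · intro j _ hji
    rw [shellFn_shellPoint_of_ne (fun h' => hji (Fin.ext h')), mul_zero]
  · intro hi'
    exact absurd hi hi'

/-- The span of the first `k` shell functions. [cite: ReedSimonIV1978, Thm. XIII.1] -/
def shellSpace (k : ℕ) : Submodule ℝ (ZM → ℝ) :=
  Submodule.span ℝ (Set.range fun m : Fin k => shellFn (m : ℕ))

/-- `dim (shellSpace k) = k`. [cite: ReedSimonIV1978, Thm. XIII.1] -/
theorem finrank_shellSpace (k : ℕ) : Module.finrank ℝ (shellSpace k) = k := by
  rw [shellSpace, finrank_span_eq_card (linearIndependent_shellFn k), Fintype.card_fin]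

/-- Elements of the span are the combinations `Σ c_m ψ_m`. [cite: ReedSimonIV1978, Thm. XIII.1] -/
theorem mem_shellSpace_iff {k : ℕ} {ψ : ZM → ℝ} :
    ψ ∈ shellSpace k ↔ ∃ c : Fin k → ℝ, ∑ m, c m • shellFn (m : ℕ) = ψ :=
  Submodule.mem_span_range_iff_exists_fun ℝ

/-- Finite combinations of trial functions are trial functions. [cite: ReedSimonIV1978, Thm. XIII.2] -/
theorem isTestFn_sum_smul {ι : Type*} (s : Finset ι) (f : ι → ZM → ℝ) (hf : ∀ i, IsTestFn (f i))
    (c : ι → ℝ) : IsTestFn (∑ i ∈ s, c i • f i) := by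
  classical
  induction s using Finset.induction_on with
  | empty => simpa using isTestFn_zero
  | insert a s ha ih =>
    rw [Finset.sum_insert ha]
    exact (IsTestFn.smul (c a) (hf a)).add ih

/-- Finite combinations of invariant functions are invariant. [cite: Vanbaal2001, §4] -/
theorem isGaugeInv_sum_smul {ι : Type*} (s : Finset ι) (f : ι → ZM → ℝ) (hf : ∀ i, IsGaugeInv (f i))
    (c : ι → ℝ) : IsGaugeInv (∑ i ∈ s, c i • f i) := by
  classical
  induction s using Finset.induction_on with
  | empty => simpa using isGaugeInv_zero
  | insert a s ha ih =>
    rw [Finset.sum_insert ha]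
    exact (IsGaugeInv.smul (c a) (hf a)).add ih

/-- Every element of `shellSpace k` is an admissible (gauge-invariant `C²_c`) trial function.
[cite: ReedSimonIV1978, Thm. XIII.2] [cite: Vanbaal2001, §4] -/
theorem adm_of_mem_shellSpace {k : ℕ} {ψ : ZM → ℝ} (h : ψ ∈ shellSpace k) :
    IsTestFn ψ ∧ IsGaugeInv ψ := by
  obtain ⟨c, rfl⟩ := mem_shellSpace_iff.1 h
  exact ⟨isTestFn_sum_smul _ _ (fun m => isTestFn_shellFn _) c,
    isGaugeInv_sum_smul _ _ (fun m => isGaugeInv_shellFn _) c⟩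

/-! ### 4. Disjoint shells diagonalise the energy form on `shellSpace k` -/

/-- The closed shells `[2m+1, 2m+2]` are pairwise disjoint. [cite: ReedSimonIV1978, Thm. XIII.1] -/
theorem shell_unique {t : ℝ} {m m' : ℕ} (h : 2 * (m : ℝ) + 1 ≤ t ∧ t ≤ 2 * m + 2)
    (h' : 2 * (m' : ℝ) + 1 ≤ t ∧ t ≤ 2 * m' + 2) : m = m' := by
  by_contra hne
  rcases lt_or_gt_of_ne hne with hlt | hgt
  · have : (m : ℝ) + 1 ≤ m' := by exact_mod_cast hlt
    linarith [h.2, h'.1]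
  · have : (m' : ℝ) + 1 ≤ m := by exact_mod_cast hgt
    linarith [h.1, h'.2]

/-- Off its closed shell, `ψ_m` vanishes identically near `x`. [cite: ReedSimonIV1978, Thm. XIII.2] -/
theorem shellFn_eventuallyEq_zero {m : ℕ} {x : ZM}
    (hx : ¬ (2 * (m : ℝ) + 1 ≤ ‖x‖ ^ 2 ∧ ‖x‖ ^ 2 ≤ 2 * m + 2)) :
    shellFn m =ᶠ[𝓝 x] fun _ => 0 := by
  have hcont : ContinuousAt (fun y : ZM => ‖y‖ ^ 2) x := (continuous_norm.pow 2).continuousAt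
  rcases not_and_or.1 hx with h | h
  · have hev : ∀ᶠ y in 𝓝 x, ‖y‖ ^ 2 < 2 * m + 1 := hcont.eventually_lt_const (not_le.1 h)
    exact hev.mono fun y hy => shellProfile_eq_zero_of_le hy.le
  · have hev : ∀ᶠ y in 𝓝 x, 2 * (m : ℝ) + 2 < ‖y‖ ^ 2 := hcont.eventually_const_lt (not_le.1 h)
    exact hev.mono fun y hy => shellProfile_eq_zero_of_ge hy.le

/-- Off its closed shell, `ψ_m(x) = 0`. [cite: ReedSimonIV1978, Thm. XIII.2] -/
theorem shellFn_eq_zero_of_not_mem {m : ℕ} {x : ZM}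
    (hx : ¬ (2 * (m : ℝ) + 1 ≤ ‖x‖ ^ 2 ∧ ‖x‖ ^ 2 ≤ 2 * m + 2)) : shellFn m x = 0 :=
  shellProfile_eq_zero_of_not_mem hx

/-- Off its closed shell, `∇ψ_m(x) = 0`. [cite: ReedSimonIV1978, Thm. XIII.2] -/
theorem gradient_shellFn_eq_zero_of_not_mem {m : ℕ} {x : ZM}
    (hx : ¬ (2 * (m : ℝ) + 1 ≤ ‖x‖ ^ 2 ∧ ‖x‖ ^ 2 ≤ 2 * m + 2)) : gradient (shellFn m) x = 0 := by
  have h := (shellFn_eventuallyEq_zero hx).fderiv_eq (𝕜 := ℝ)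
  rw [gradient, h]
  simp

/-- `ψ_m` is differentiable. [cite: ReedSimonIV1978, Thm. XIII.2] -/
theorem differentiable_shellFn (m : ℕ) : Differentiable ℝ (shellFn m) :=
  (shellFn_contDiff m (n := 1)).differentiable (by norm_num)

/-- Gradient of a combination of shells. [cite: ReedSimonIV1978, Thm. XIII.2] -/
theorem gradient_sum_smul_shellFn {k : ℕ} (c : Fin k → ℝ) (x : ZM) :
    gradient (∑ m, c m • shellFn (m : ℕ)) x = ∑ m, c m • gradient (shellFn (m : ℕ)) x := by
  have hf : (∑ m, c m • shellFn (m : ℕ) : ZM → ℝ) = fun y => ∑ m, c m • shellFn (m : ℕ) y := by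
    funext y
    simp [Finset.sum_apply]
  have hD : HasFDerivAt (fun y => ∑ m, c m • shellFn (m : ℕ) y)
      (∑ m, c m • fderiv ℝ (shellFn (m : ℕ)) x) x :=
    HasFDerivAt.fun_sum fun m _ => ((differentiable_shellFn (m : ℕ) x).hasFDerivAt.const_smul (c m))
  rw [gradient, hf, hD.fderiv, map_sum]
  refine Finset.sum_congr rfl fun m _ => ?_
  rw [map_smul]
  rfl

/-- A sum with at most one non-zero term, squared (real version). [folklore] -/
private theorem sq_sum_mul_of_atMostOne {k : ℕ} (a b : Fin k → ℝ)
    (h : ∀ m m', b m ≠ 0 → b m' ≠ 0 → m = m') :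
    (∑ m, a m * b m) ^ 2 = ∑ m, a m ^ 2 * b m ^ 2 := by
  by_cases hex : ∃ m₀, b m₀ ≠ 0
  · obtain ⟨m₀, hm₀⟩ := hex
    have hz : ∀ m, m ≠ m₀ → b m = 0 := fun m hm => by
      by_contra hb
      exact hm (h m m₀ hb hm₀)
    rw [Finset.sum_eq_single m₀ (fun m _ hm => by rw [hz m hm, mul_zero]) (by simp),
      Finset.sum_eq_single m₀ (fun m _ hm => by rw [hz m hm]; ring) (by simp)]
    ring
  · have hz : ∀ m, b m = 0 := fun m => by
      by_contra hb
      exact hex ⟨m, hb⟩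
    simp [hz]

/-- A sum with at most one non-zero term, norm squared (vector version). [folklore] -/
private theorem norm_sq_sum_smul_of_atMostOne {k : ℕ} (a : Fin k → ℝ) (v : Fin k → ZM)
    (h : ∀ m m', v m ≠ 0 → v m' ≠ 0 → m = m') :
    ‖∑ m, a m • v m‖ ^ 2 = ∑ m, a m ^ 2 * ‖v m‖ ^ 2 := by
  by_cases hex : ∃ m₀, v m₀ ≠ 0
  · obtain ⟨m₀, hm₀⟩ := hex
    have hz : ∀ m, m ≠ m₀ → v m = 0 := fun m hm => by
      by_contra hb
      exact hm (h m m₀ hb hm₀)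
    rw [Finset.sum_eq_single m₀ (fun m _ hm => by rw [hz m hm, smul_zero]) (by simp),
      Finset.sum_eq_single m₀ (fun m _ hm => by rw [hz m hm]; simp) (by simp), norm_smul, mul_pow,
      Real.norm_eq_abs, sq_abs]
  · have hz : ∀ m, v m = 0 := fun m => by
      by_contra hb
      exact hex ⟨m, hb⟩
    simp [hz]

/-- **Diagonalisation of the energy integrand on the shells**: pointwise,
`½|∇(Σ c_m ψ_m)|² + V (Σ c_m ψ_m)² = Σ c_m² (½|∇ψ_m|² + V ψ_m²)` (at each point at most one shell is
active, values AND gradients). [cite: ReedSimonIV1978, Thm. XIII.1] -/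
theorem energyIntegrand_sum_smul_shellFn {k : ℕ} (c : Fin k → ℝ) (x : ZM) :
    (1 / 2 : ℝ) * ‖gradient (∑ m, c m • shellFn (m : ℕ)) x‖ ^ 2 +
        luscherPotential x * (∑ m, c m • shellFn (m : ℕ)) x ^ 2 =
      ∑ m, c m ^ 2 * ((1 / 2 : ℝ) * ‖gradient (shellFn (m : ℕ)) x‖ ^ 2 +
        luscherPotential x * shellFn (m : ℕ) x ^ 2) := by
  have hat1 : ∀ m m' : Fin k, gradient (shellFn (m : ℕ)) x ≠ 0 → gradient (shellFn (m' : ℕ)) x ≠ 0 → m = m' := by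
    intro m m' hm hm'
    have h1 : 2 * ((m : ℕ) : ℝ) + 1 ≤ ‖x‖ ^ 2 ∧ ‖x‖ ^ 2 ≤ 2 * ((m : ℕ) : ℝ) + 2 := by
      by_contra hx
      exact hm (gradient_shellFn_eq_zero_of_not_mem hx)
    have h2 : 2 * ((m' : ℕ) : ℝ) + 1 ≤ ‖x‖ ^ 2 ∧ ‖x‖ ^ 2 ≤ 2 * ((m' : ℕ) : ℝ) + 2 := by
      by_contra hx
      exact hm' (gradient_shellFn_eq_zero_of_not_mem hx)
    exact Fin.ext (shell_unique h1 h2)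
  have hat2 : ∀ m m' : Fin k, shellFn (m : ℕ) x ≠ 0 → shellFn (m' : ℕ) x ≠ 0 → m = m' := by
    intro m m' hm hm'
    have h1 : 2 * ((m : ℕ) : ℝ) + 1 ≤ ‖x‖ ^ 2 ∧ ‖x‖ ^ 2 ≤ 2 * ((m : ℕ) : ℝ) + 2 := by
      by_contra hx
      exact hm (shellFn_eq_zero_of_not_mem hx)
    have h2 : 2 * ((m' : ℕ) : ℝ) + 1 ≤ ‖x‖ ^ 2 ∧ ‖x‖ ^ 2 ≤ 2 * ((m' : ℕ) : ℝ) + 2 := by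
      by_contra hx
      exact hm' (shellFn_eq_zero_of_not_mem hx)
    exact Fin.ext (shell_unique h1 h2)
  have hval : (∑ m, c m • shellFn (m : ℕ) : ZM → ℝ) x = ∑ m, c m * shellFn (m : ℕ) x := by
    simp [Finset.sum_apply]
  rw [gradient_sum_smul_shellFn, hval, norm_sq_sum_smul_of_atMostOne _ _ hat1,
    sq_sum_mul_of_atMostOne _ _ hat2, Finset.mul_sum, Finset.mul_sum, ← Finset.sum_add_distrib]
  exact Finset.sum_congr rfl fun m _ => by ring

/-- Continuity of Lüscher's potential. [cite: SimonB1983DiscreteSpectrum, eq. (3) p. 211] -/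
theorem continuous_luscherPotential : Continuous luscherPotential := by
  have hc : ∀ p : Fin 3 × Fin 3, Continuous fun x : ZM => x p := fun p => (EuclideanSpace.proj p).continuous
  have hdot : ∀ i j : Fin 3, Continuous fun x : ZM => colourVec x i ⬝ᵥ colourVec x j := fun i j =>
    continuous_finsetSum _ fun b _ => (hc (i, b)).mul (hc (j, b))
  have h : luscherPotential = fun x => (1 / 4 : ℝ) * ∑ i, ∑ j,
      ((colourVec x i ⬝ᵥ colourVec x i) * (colourVec x j ⬝ᵥ colourVec x j) -
        (colourVec x i ⬝ᵥ colourVec x j) * (colourVec x j ⬝ᵥ colourVec x i)) := by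
    funext x
    simp only [luscherPotential, cross_dot_cross]
  rw [h]
  exact continuous_const.mul (continuous_finsetSum _ fun i _ => continuous_finsetSum _ fun j _ =>
    ((hdot i i).mul (hdot j j)).sub ((hdot i j).mul (hdot j i)))

/-- The gradient of a shell function is continuous. [cite: ReedSimonIV1978, Thm. XIII.2] -/
theorem continuous_gradient_shellFn (m : ℕ) : Continuous fun x => gradient (shellFn m) x :=
  (InnerProductSpace.toDual ℝ ZM).symm.continuous.comp
    ((shellFn_contDiff m (n := 1)).continuous_fderiv (by norm_num))

/-- Outside the ball of radius `√(2m+2)` a point lies off the `m`-th closed shell. [cite: ReedSimonIV1978, Thm. XIII.2] -/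
theorem not_mem_shell_of_not_mem_closedBall {m : ℕ} {x : ZM}
    (hx : x ∉ Metric.closedBall (0 : ZM) (Real.sqrt (2 * m + 2))) :
    ¬ (2 * (m : ℝ) + 1 ≤ ‖x‖ ^ 2 ∧ ‖x‖ ^ 2 ≤ 2 * m + 2) := by
  rw [Metric.mem_closedBall, dist_zero_right, not_le] at hx
  have h0 : (0 : ℝ) ≤ 2 * m + 2 := by positivity
  have h1 : Real.sqrt (2 * m + 2) ^ 2 = 2 * m + 2 := Real.sq_sqrt h0
  intro h
  nlinarith [Real.sqrt_nonneg (2 * (m : ℝ) + 2), norm_nonneg x, h.2]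

/-- The energy integrand of a shell function is integrable (continuous, compact support).
[cite: ReedSimonIV1978, Thm. XIII.2] -/
theorem integrable_energyIntegrand_shellFn (m : ℕ) :
    Integrable fun x => (1 / 2 : ℝ) * ‖gradient (shellFn m) x‖ ^ 2 + luscherPotential x * shellFn m x ^ 2 := by
  refine Continuous.integrable_of_hasCompactSupport ?_ ?_
  · exact (continuous_const.mul ((continuous_gradient_shellFn m).norm.pow 2)).add
      (continuous_luscherPotential.mul ((shellFn_contDiff m (n := 0)).continuous.pow 2))
  · refine HasCompactSupport.intro (isCompact_closedBall (0 : ZM) (Real.sqrt (2 * m + 2))) fun x hx => ?_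
    have h := not_mem_shell_of_not_mem_closedBall hx
    rw [gradient_shellFn_eq_zero_of_not_mem h, shellFn_eq_zero_of_not_mem h]
    simp

/-- `ψ_m²` has compact support. [cite: ReedSimonIV1978, Thm. XIII.2] -/
theorem hasCompactSupport_sq_shellFn (m : ℕ) : HasCompactSupport fun x => shellFn m x ^ 2 := by
  refine HasCompactSupport.intro (isCompact_closedBall (0 : ZM) (Real.sqrt (2 * m + 2))) fun x hx => ?_
  have h := not_mem_shell_of_not_mem_closedBall hx
  simp [shellFn_eq_zero_of_not_mem h]

/-- `ψ_m²` is integrable. [cite: ReedSimonIV1978, Thm. XIII.2] -/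
theorem integrable_sq_shellFn (m : ℕ) : Integrable fun x => shellFn m x ^ 2 :=
  ((shellFn_contDiff m (n := 0)).continuous.pow 2).integrable_of_hasCompactSupport
    (hasCompactSupport_sq_shellFn m)

/-- **The energy form is diagonal on the shells**: `𝔮(Σ c_m ψ_m) = Σ c_m² 𝔮(ψ_m)`.
[cite: ReedSimonIV1978, Thm. XIII.1] -/
theorem energyForm_sum_smul_shellFn {k : ℕ} (c : Fin k → ℝ) :
    energyForm (∑ m, c m • shellFn (m : ℕ)) = ∑ m, c m ^ 2 * energyForm (shellFn (m : ℕ)) := by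
  unfold energyForm
  simp_rw [energyIntegrand_sum_smul_shellFn c]
  rw [integral_finsetSum Finset.univ (f := fun (m : Fin k) (x : ZM) => c m ^ 2 *
      ((1 / 2 : ℝ) * ‖gradient (shellFn (m : ℕ)) x‖ ^ 2 + luscherPotential x * shellFn (m : ℕ) x ^ 2))
      (fun m _ => (integrable_energyIntegrand_shellFn (m : ℕ)).const_mul _)]
  exact Finset.sum_congr rfl fun m _ => integral_const_mul _ _

/-- **The `L²` norm is diagonal on the shells**: `‖Σ c_m ψ_m‖² = Σ c_m² ‖ψ_m‖²`.
[cite: ReedSimonIV1978, Thm. XIII.1] -/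
theorem l2sq_sum_smul_shellFn {k : ℕ} (c : Fin k → ℝ) :
    l2sq (∑ m, c m • shellFn (m : ℕ)) = ∑ m, c m ^ 2 * l2sq (shellFn (m : ℕ)) := by
  unfold l2sq
  have hpt : ∀ x, (∑ m, c m • shellFn (m : ℕ) : ZM → ℝ) x ^ 2 = ∑ m, c m ^ 2 * shellFn (m : ℕ) x ^ 2 := by
    intro x
    have hat2 : ∀ m m' : Fin k, shellFn (m : ℕ) x ≠ 0 → shellFn (m' : ℕ) x ≠ 0 → m = m' := by
      intro m m' hm hm'
      have h1 : 2 * ((m : ℕ) : ℝ) + 1 ≤ ‖x‖ ^ 2 ∧ ‖x‖ ^ 2 ≤ 2 * ((m : ℕ) : ℝ) + 2 := by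
        by_contra hx
        exact hm (shellFn_eq_zero_of_not_mem hx)
      have h2 : 2 * ((m' : ℕ) : ℝ) + 1 ≤ ‖x‖ ^ 2 ∧ ‖x‖ ^ 2 ≤ 2 * ((m' : ℕ) : ℝ) + 2 := by
        by_contra hx
        exact hm' (shellFn_eq_zero_of_not_mem hx)
      exact Fin.ext (shell_unique h1 h2)
    have hval : (∑ m, c m • shellFn (m : ℕ) : ZM → ℝ) x = ∑ m, c m * shellFn (m : ℕ) x := by
      simp [Finset.sum_apply]
    rw [hval, sq_sum_mul_of_atMostOne _ _ hat2]
  simp_rw [hpt]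
  rw [integral_finsetSum Finset.univ (f := fun (m : Fin k) (x : ZM) => c m ^ 2 * shellFn (m : ℕ) x ^ 2)
      (fun m _ => (integrable_sq_shellFn (m : ℕ)).const_mul _)]
  exact Finset.sum_congr rfl fun m _ => integral_const_mul _ _

/-- `‖ψ_m‖²_{L²} > 0`. [cite: ReedSimonIV1978, Thm. XIII.2] -/
theorem l2sq_shellFn_pos (m : ℕ) : 0 < l2sq (shellFn m) :=
  Continuous.integral_pos_of_hasCompactSupport_nonneg_nonzero ((shellFn_contDiff m (n := 0)).continuous.pow 2)
    (hasCompactSupport_sq_shellFn m) (fun _ => sq_nonneg _)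
    (x := shellPoint m) (pow_ne_zero 2 (shellFn_shellPoint_pos m).ne')

/-- `𝔮(ψ) ≥ 0` for every `ψ`. [folklore] -/
private theorem energyForm_nonneg' (ψ : ZM → ℝ) : 0 ≤ energyForm ψ :=
  integral_nonneg fun x => add_nonneg (mul_nonneg (by norm_num) (sq_nonneg _))
    (mul_nonneg (luscherPotential_nonneg x) (sq_nonneg _))

/-! ### 5. The min–max levels are genuine infima: non-empty, bounded below, monotone -/

/-- The Rayleigh set of order `k`: the numbers `s` admitting a `k`-dimensional space of admissible trial
functions with Rayleigh quotient `≤ s` throughout (the set whose infimum is `physLevel k`).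
[cite: ReedSimonIV1978, Thm. XIII.1] -/
def levelSet (k : ℕ) : Set ℝ :=
  {s : ℝ | ∃ W : Submodule ℝ (ZM → ℝ), Module.finrank ℝ W = k ∧ (∀ ψ ∈ W, IsTestFn ψ ∧ IsGaugeInv ψ) ∧
    ∀ ψ ∈ W, energyForm ψ ≤ s * l2sq ψ}

/-- `physLevel k = inf (levelSet k)` (definitional). [cite: ReedSimonIV1978, Thm. XIII.1] -/
theorem physLevel_eq_sInf (k : ℕ) : physLevel k = sInf (levelSet k) := rfl

/-- The explicit shell bound `s_k := Σ_{m<k} 𝔮(ψ_m)/‖ψ_m‖²`. [cite: ReedSimonIV1978, Thm. XIII.1] -/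
def shellBound (k : ℕ) : ℝ := ∑ m : Fin k, energyForm (shellFn (m : ℕ)) / l2sq (shellFn (m : ℕ))

/-- On `shellSpace k` the Rayleigh quotient is `≤ s_k`. [cite: ReedSimonIV1978, Thm. XIII.1] -/
theorem energyForm_le_shellBound_mul {k : ℕ} {ψ : ZM → ℝ} (h : ψ ∈ shellSpace k) :
    energyForm ψ ≤ shellBound k * l2sq ψ := by
  obtain ⟨c, rfl⟩ := mem_shellSpace_iff.1 h
  rw [energyForm_sum_smul_shellFn, l2sq_sum_smul_shellFn, Finset.mul_sum]
  refine Finset.sum_le_sum fun m _ => ?_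
  have hN := l2sq_shellFn_pos (m : ℕ)
  have hratio : energyForm (shellFn (m : ℕ)) / l2sq (shellFn (m : ℕ)) ≤ shellBound k :=
    Finset.single_le_sum (f := fun m : Fin k => energyForm (shellFn (m : ℕ)) / l2sq (shellFn (m : ℕ)))
      (fun m _ => div_nonneg (energyForm_nonneg' _) (l2sq_nonneg _)) (Finset.mem_univ m)
  have hE : energyForm (shellFn (m : ℕ)) ≤ shellBound k * l2sq (shellFn (m : ℕ)) := by
    rwa [div_le_iff₀ hN] at hratio
  nlinarith [sq_nonneg (c m)]

/-- **The Rayleigh sets are non-empty** (`s_k ∈ levelSet k`: the `k` disjoint radial shells).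
[cite: ReedSimonIV1978, Thm. XIII.1] -/
theorem shellBound_mem_levelSet (k : ℕ) : shellBound k ∈ levelSet k :=
  ⟨shellSpace k, finrank_shellSpace k, fun _ h => adm_of_mem_shellSpace h, fun _ h => energyForm_le_shellBound_mul h⟩

/-- The Rayleigh sets are non-empty. [cite: ReedSimonIV1978, Thm. XIII.1] -/
theorem levelSet_nonempty (k : ℕ) : (levelSet k).Nonempty := ⟨_, shellBound_mem_levelSet k⟩

/-- A non-zero admissible trial function has `‖ψ‖²_{L²} > 0`. [cite: ReedSimonIV1978, Thm. XIII.2] -/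
theorem l2sq_pos_of_ne_zero {ψ : ZM → ℝ} (hψ : IsTestFn ψ) (hne : ψ ≠ 0) : 0 < l2sq ψ := by
  obtain ⟨x, hx⟩ := Function.ne_iff.1 hne
  exact Continuous.integral_pos_of_hasCompactSupport_nonneg_nonzero (hψ.1.continuous.pow 2)
    (hψ.2.comp_left (g := fun t : ℝ => t ^ 2) (by simp)) (fun _ => sq_nonneg _) (x := x) (pow_ne_zero 2 hx)

/-- **Every element of a Rayleigh set of order `k ≥ 1` is `≥ 0`** (`𝔮 ≥ 0` and a `k`-dimensional space
contains a non-zero continuous function, whose `L²` norm is positive). [cite: ReedSimonIV1978, Thm. XIII.1] -/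
theorem nonneg_of_mem_levelSet {k : ℕ} (hk : 1 ≤ k) {s : ℝ} (hs : s ∈ levelSet k) : 0 ≤ s := by
  obtain ⟨W, hW, hadm, hray⟩ := hs
  obtain ⟨n, rfl⟩ : ∃ n, k = n + 1 := ⟨k - 1, by omega⟩
  haveI : Module.Finite ℝ W := Module.finite_of_finrank_eq_succ hW
  let b := Module.finBasisOfFinrankEq ℝ W hW
  have hb : (b 0 : ZM → ℝ) ≠ 0 := fun h => b.ne_zero 0 (Subtype.ext h)
  have hmem : (b 0 : ZM → ℝ) ∈ W := (b 0).2
  have hpos := l2sq_pos_of_ne_zero (hadm _ hmem).1 hb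
  have h := hray _ hmem
  nlinarith [energyForm_nonneg' (b 0 : ZM → ℝ)]

/-- The Rayleigh sets of order `k ≥ 1` are bounded below (by `0`). [cite: ReedSimonIV1978, Thm. XIII.1] -/
theorem levelSet_bddBelow {k : ℕ} (hk : 1 ≤ k) : BddBelow (levelSet k) :=
  ⟨0, fun _ hs => nonneg_of_mem_levelSet hk hs⟩

/-- **The Rayleigh sets decrease with the order**: a `(k+1)`-dimensional admissible space with Rayleigh
quotient `≤ s` contains a `k`-dimensional one. [cite: ReedSimonIV1978, Thm. XIII.1] -/
theorem levelSet_succ_subset (k : ℕ) : levelSet (k + 1) ⊆ levelSet k := by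
  rintro s ⟨W, hW, hadm, hray⟩
  haveI : Module.Finite ℝ W := Module.finite_of_finrank_eq_succ hW
  let b := Module.finBasisOfFinrankEq ℝ W hW
  let v : Fin k → ZM → ℝ := fun i => (b (Fin.castSucc i) : ZM → ℝ)
  have hv : LinearIndependent ℝ v := by
    have h1 : LinearIndependent ℝ (fun i => b (Fin.castSucc i)) :=
      b.linearIndependent.comp _ (Fin.castSucc_injective k)
    exact h1.map' W.subtype (Submodule.ker_subtype W)
  refine ⟨Submodule.span ℝ (Set.range v), ?_, ?_, ?_⟩
  · rw [finrank_span_eq_card hv, Fintype.card_fin]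
  · intro ψ hψ
    refine hadm ψ (Submodule.span_le.2 ?_ hψ)
    rintro _ ⟨i, rfl⟩
    exact (b _).2
  · intro ψ hψ
    refine hray ψ (Submodule.span_le.2 ?_ hψ)
    rintro _ ⟨i, rfl⟩
    exact (b _).2

/-- **`μ_k^inv ≥ 0`** (`k ≥ 1`). [cite: ReedSimonIV1978, Thm. XIII.1] -/
theorem physLevel_nonneg {k : ℕ} (hk : 1 ≤ k) : 0 ≤ physLevel k := by
  rw [physLevel_eq_sInf]
  exact le_csInf (levelSet_nonempty k) fun s hs => nonneg_of_mem_levelSet hk hs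

/-- **`μ_k^inv ≤ s` for every `s` in the Rayleigh set** (the infimum is attained from above; `k ≥ 1`).
[cite: ReedSimonIV1978, Thm. XIII.1] -/
theorem physLevel_le_of_mem {k : ℕ} (hk : 1 ≤ k) {s : ℝ} (hs : s ∈ levelSet k) : physLevel k ≤ s := by
  rw [physLevel_eq_sInf]
  exact csInf_le (levelSet_bddBelow hk) hs

/-- **Explicit finite upper bound**: `μ_k^inv ≤ s_k = Σ_{m<k} 𝔮(ψ_m)/‖ψ_m‖²` — every level is a real number,
witnessed by the radial shells. [cite: ReedSimonIV1978, Thm. XIII.1] -/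
theorem physLevel_le_shellBound {k : ℕ} (hk : 1 ≤ k) : physLevel k ≤ shellBound k :=
  physLevel_le_of_mem hk (shellBound_mem_levelSet k)

/-- **Monotonicity of the levels**: `μ_k^inv ≤ μ_{k+1}^inv` (`k ≥ 1`). [cite: ReedSimonIV1978, Thm. XIII.1] -/
theorem physLevel_le_succ {k : ℕ} (hk : 1 ≤ k) : physLevel k ≤ physLevel (k + 1) := by
  rw [physLevel_eq_sInf, physLevel_eq_sInf]
  exact csInf_le_csInf (levelSet_bddBelow hk) (levelSet_nonempty (k + 1)) (levelSet_succ_subset k)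

/-- Monotonicity along the order: `μ_k^inv ≤ μ_l^inv` for `1 ≤ k ≤ l`. [cite: ReedSimonIV1978, Thm. XIII.1] -/
theorem physLevel_mono {k l : ℕ} (hk : 1 ≤ k) (hkl : k ≤ l) : physLevel k ≤ physLevel l := by
  induction l, hkl using Nat.le_induction with
  | base => exact le_rfl
  | succ l hl ih => exact ih.trans (physLevel_le_succ (hk.trans hl))

/-- **`ε₁ ≥ 0`**: Lüscher's first excitation `luscherEps1 = μ_2^inv − μ_1^inv` is a well-defined
non-negative real number (its STRICT positivity is the simplicity half of the named fact
`LuscherSimonGap`, not proved here). [cite: Luscher1983, §1] [cite: ReedSimonIV1978, Thm. XIII.1] -/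
theorem luscherEps1_nonneg : 0 ≤ luscherEps1 :=
  sub_nonneg.2 (physLevel_le_succ le_rfl)

/-- Scaling of the energy form: `𝔮(aψ) = a² 𝔮(ψ)` for differentiable `ψ`. [cite: ReedSimonIV1978, Thm. XIII.2] -/
theorem energyForm_smul {ψ : ZM → ℝ} (hψ : Differentiable ℝ ψ) (a : ℝ) :
    energyForm (a • ψ) = a ^ 2 * energyForm ψ := by
  unfold energyForm
  rw [← integral_const_mul]
  refine integral_congr_ae (Eventually.of_forall fun x => ?_)
  have hgr : gradient (a • ψ) x = a • gradient ψ x := by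
    rw [gradient, gradient, fderiv_const_smul (hψ x) a, map_smul]
  simp only [hgr, norm_smul, Real.norm_eq_abs, mul_pow, sq_abs, Pi.smul_apply, smul_eq_mul]
  ring

/-- Scaling of the `L²` norm: `‖aψ‖² = a² ‖ψ‖²`. [cite: ReedSimonIV1978, Thm. XIII.2] -/
theorem l2sq_smul (ψ : ZM → ℝ) (a : ℝ) : l2sq (a • ψ) = a ^ 2 * l2sq ψ := by
  unfold l2sq
  rw [← integral_const_mul]
  refine integral_congr_ae (Eventually.of_forall fun x => ?_)
  simp only [Pi.smul_apply, smul_eq_mul, mul_pow]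

/-- **Variational principle for the ground level**: `μ_1^inv ≤ 𝔮(ψ)/‖ψ‖²` for every non-zero admissible
trial function `ψ` (the line `ℝψ` is a one-dimensional admissible space with Rayleigh quotient
`𝔮(ψ)/‖ψ‖²`). [cite: ReedSimonIV1978, Thm. XIII.1] -/
theorem physLevel_one_le_rayleigh {ψ : ZM → ℝ} (hψ : IsTestFn ψ) (hg : IsGaugeInv ψ) (hne : ψ ≠ 0) :
    physLevel 1 ≤ energyForm ψ / l2sq ψ := by
  have hpos := l2sq_pos_of_ne_zero hψ hne
  have hd : Differentiable ℝ ψ := hψ.1.differentiable (by norm_num)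
  refine physLevel_le_of_mem le_rfl ⟨Submodule.span ℝ {ψ}, ?_, ?_, ?_⟩
  · exact finrank_span_singleton hne
  · intro φ hφ
    obtain ⟨a, rfl⟩ := Submodule.mem_span_singleton.1 hφ
    exact ⟨hψ.smul a, hg.smul a⟩
  · intro φ hφ
    obtain ⟨a, rfl⟩ := Submodule.mem_span_singleton.1 hφ
    rw [energyForm_smul hd, l2sq_smul, ← mul_assoc, mul_comm (energyForm ψ / l2sq ψ), mul_assoc,
      div_mul_cancel₀ _ hpos.ne']

end Literature.Analysis.OperatorTheory.YMMatrixModel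

end
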